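import Summits.Ventures.CertifiedArithmetic.LowPrec.SRTreeCertificates
import Summits.Ventures.CertifiedArithmetic.LowPrec.SRWindow
import Summits.Ventures.CertifiedArithmetic.LowPrec.SRLimitedBits
import HarnessLib

/-!
# Stochastic rounding into a finite format, VIII: interval certificates for any summation tree

HONEST FRAMING: certified error envelopes and provably optimal rounding/accumulation schemes for
low-precision formats under stated cost models; every table by two implementations; no hardware or
vendor claims.

The envelopes of files V–VII (`treeVar ≤ m·G²/4`, exponential tails) use ONE gap constant `G` for the
whole tree, and the sharper path predicates (`NoSatT`, `GapLET`, `InWindow`) cost `2^m` branches to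
decide. This file gives POLYNOMIAL-COST certificates valid for every tree and all leaves:

* deterministic range propagation `lbT ≤ ŝ_T ≤ ubT` on every branch (`allOut_range`; the candidates
  are monotone), hence an interval certificate for no saturation (`HullCert ⇒ NoSatT`,
  `noSatT_of_hullCert`) of cost `O(m)`;
* the **interval envelope** `treeVar F T ≤ envI F T := Σ_{nodes v} locGap(F, window_v)²/4`
  (`treeVar_le_envI`) with NO hypothesis: `window_v = [dn(lb_l + lb_r), up(ub_l + ub_r)]` is where
  node `v`'s pre-rounding value provably lies and `locGap` is the largest spacing of `F` met on it
  (`gap_le_locGap`, from the window lemma of `SRWindow`); cost `O(m·|F|²)`, kernel-decidable for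
  trees far beyond enumeration (E4M3, 32 leaves below);
* Chebyshev with the interval envelope (`tree_prob_dev_ge_le_envI`).

This is the format-exact content of "pairwise summation keeps the partial sums small": in the
absolute model the benefit of a balanced tree is not fewer roundings (always `m = n − 1`) but smaller
windows, node by node. Kernel instances (`decide +kernel`): E3M2, leaves `(1, 5/4, 3/2, 7/4)²`:
balanced `Var = 1 ≤ envI = 7/4`, sequential `Var = 7/4 ≤ envI = 29/8`; eight copies of `5/4`:
balanced EXACT (`envI = 0`, so `Var = 0`), sequential `Var = 2335/1024`; E3M2 `(3,3,3,3)`: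
sequential `Var = 2 = envI` (tight); E4M3 leaves `1 + (i mod 8)/8`: `envI` balanced `15/8` vs
sequential `237/32` at 16 leaves and `31/4` vs `4397/32` at 32 leaves (certificates where the
`2^31`-branch enumeration is out of reach; the sequential certificate is loose because the support of
a sequential SR sum genuinely spreads upward through coarser binades).
-/

namespace Summit.Ventures.CertifiedArithmetic.LowPrec.SR

open Literature.ComputerArithmetic.ConnollyHighamMary2021 Finset STree

variable {K : Type*} [Field K] [LinearOrder K] [IsStrictOrderedRing K]

/-! ### Monotonicity of clamp and of the candidates -/

omit [Field K] [IsStrictOrderedRing K] in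
/-- `clamp` is monotone. -/
theorem clamp_mono {F : Finset K} (hF : F.Nonempty) {x y : K} (h : x ≤ y) :
    clamp F x ≤ clamp F y := by
  unfold clamp; rw [dif_pos hF, dif_pos hF]
  exact max_le_max le_rfl (min_le_min h le_rfl)

omit [Field K] [IsStrictOrderedRing K] in
/-- `⌈·⌉` is monotone (below some element of `F`). -/
theorem roundUp_mono {F : Finset K} {x y : K} (h : x ≤ y) (hy : ∃ z ∈ F, y ≤ z) :
    roundUp F x ≤ roundUp F y :=
  roundUp_le_of_mem (roundUp_mem hy) (h.trans (le_roundUp F y))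

omit [Field K] [IsStrictOrderedRing K] in
/-- `⌊·⌋` is monotone (above some element of `F`). -/
theorem roundDown_mono {F : Finset K} {x y : K} (h : x ≤ y) (hx : ∃ z ∈ F, z ≤ x) :
    roundDown F x ≤ roundDown F y :=
  le_roundDown_of_mem (roundDown_mem hx) ((roundDown_le F x).trans h)

omit [Field K] [IsStrictOrderedRing K] in
/-- The upper outcome `up F c = ⌈c̄⌉` is monotone in `c`. -/
theorem up_mono {F : Finset K} (hF : F.Nonempty) {x y : K} (h : x ≤ y) : up F x ≤ up F y :=
  roundUp_mono (clamp_mono hF h) (clamp_inHull hF y).2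

omit [Field K] [IsStrictOrderedRing K] in
/-- The lower outcome `dn F c = ⌊c̄⌋` is monotone in `c`. -/
theorem dn_mono {F : Finset K} (hF : F.Nonempty) {x y : K} (h : x ≤ y) : dn F x ≤ dn F y :=
  roundDown_mono (clamp_mono hF h) (clamp_inHull hF x).1

omit [Field K] [IsStrictOrderedRing K] in
/-- `⌊c̄⌋ ≤ c̄`. -/
theorem dn_le_clamp (F : Finset K) (c : K) : dn F c ≤ clamp F c := roundDown_le F _

omit [Field K] [IsStrictOrderedRing K] in
/-- `c̄ ≤ ⌈c̄⌉`. -/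
theorem clamp_le_up (F : Finset K) (c : K) : clamp F c ≤ up F c := le_roundUp F _

/-! ### Deterministic range propagation -/

/-- Upper range bound: leaves themselves, `up` of the sum of the children's bounds at a node. -/
def ubT (F : Finset K) : STree K → K
  | .leaf x => x
  | .node l r => up F (ubT F l + ubT F r)

/-- Lower range bound. -/
def lbT (F : Finset K) : STree K → K
  | .leaf x => x
  | .node l r => dn F (lbT F l + lbT F r)

/-- **Every outcome lies in the propagated range** `[lbT, ubT]`. -/
theorem allOut_range {F : Finset K} (hF : F.Nonempty) :
    ∀ t : STree K, AllOut F t (fun v => lbT F t ≤ v ∧ v ≤ ubT F t)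
  | .leaf _ => ⟨le_rfl, le_rfl⟩
  | .node l r => by
      simp only [AllOut, lbT, ubT]
      refine allOut_mono F l (fun a ha => ?_) (allOut_range hF l)
      refine allOut_mono F r (fun b hb => ?_) (allOut_range hF r)
      have h1 : lbT F l + lbT F r ≤ a + b := add_le_add ha.1 hb.1
      have h2 : a + b ≤ ubT F l + ubT F r := add_le_add ha.2 hb.2
      have hdu : ∀ c : K, dn F c ≤ up F c := fun c => LimitedBits.dn_le_up F c
      exact ⟨⟨(dn_mono hF h1).trans (hdu _), up_mono hF h2⟩, dn_mono hF h1,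
        (hdu _).trans (up_mono hF h2)⟩

/-! ### Interval certificate for no saturation (cost `O(m)`) -/

/-- `HullCert F T`: at every node the extreme pre-rounding values `lb_l + lb_r`, `ub_l + ub_r` lie in
the hull of `F`. -/
def HullCert (F : Finset K) : STree K → Prop
  | .leaf _ => True
  | .node l r => HullCert F l ∧ HullCert F r ∧ InHull F (lbT F l + lbT F r)
      ∧ InHull F (ubT F l + ubT F r)

/-- **Range certificate ⇒ no saturating branch.** -/
theorem noSatT_of_hullCert {F : Finset K} (hF : F.Nonempty) : ∀ t : STree K, HullCert F t → NoSatT F t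
  | .leaf _, _ => trivial
  | .node l r, ⟨hl, hr, hlo, hhi⟩ => by
      refine ⟨noSatT_of_hullCert hF l hl, noSatT_of_hullCert hF r hr, ?_⟩
      refine allOut_mono F l (fun a ha => ?_) (allOut_range hF l)
      refine allOut_mono F r (fun b hb => ?_) (allOut_range hF r)
      obtain ⟨y, hy, hyl⟩ := hlo.1
      obtain ⟨z, hz, hzu⟩ := hhi.2
      exact ⟨⟨y, hy, hyl.trans (add_le_add ha.1 hb.1)⟩, ⟨z, hz, (add_le_add ha.2 hb.2).trans hzu⟩⟩

/-- `HullCert` is decidable (two hull tests per node). -/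
instance instDecidableHullCert (F : Finset K) : ∀ t : STree K, Decidable (HullCert F t)
  | .leaf _ => inferInstanceAs (Decidable True)
  | .node l r =>
      haveI := instDecidableHullCert F l
      haveI := instDecidableHullCert F r
      inferInstanceAs (Decidable (HullCert F l ∧ HullCert F r ∧ InHull F (lbT F l + lbT F r)
        ∧ InHull F (ubT F l + ubT F r)))

/-! ### Local spacing of a window -/

/-- The successor of `a` in `F` (junk value `a` if none). -/
def succF (F : Finset K) (a : K) : K :=
  if h : (F.filter (fun b => a < b)).Nonempty then (F.filter (fun b => a < b)).min' h else a

omit [Field K] [IsStrictOrderedRing K] in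
/-- If `F` has an element above `a`, `succF F a` is one, and the least. -/
theorem succF_mem_and_lt {F : Finset K} {a : K} (h : ∃ b ∈ F, a < b) :
    succF F a ∈ F ∧ a < succF F a := by
  have hne : (F.filter (fun b => a < b)).Nonempty := by
    obtain ⟨b, hb, hab⟩ := h; exact ⟨b, mem_filter.mpr ⟨hb, hab⟩⟩
  unfold succF; rw [dif_pos hne]
  exact ⟨(mem_filter.mp (min'_mem _ hne)).1, (mem_filter.mp (min'_mem _ hne)).2⟩

/-- `locGap F lo hi`: the largest spacing `succ(a) − a` over `a ∈ F ∩ [lo, hi)` (`0` if none). -/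
def locGap (F : Finset K) (lo hi : K) : K :=
  ((F.filter (fun a => lo ≤ a ∧ a < hi)).image (fun a => succF F a - a)).fold max 0 id

omit [IsStrictOrderedRing K] in
/-- `0 ≤ locGap`. -/
theorem locGap_nonneg (F : Finset K) (lo hi : K) : 0 ≤ locGap F lo hi := by
  unfold locGap; exact (Finset.le_fold_max _).mpr (Or.inl le_rfl)

omit [IsStrictOrderedRing K] in
/-- Every spacing met on the window is `≤ locGap`. -/
theorem le_locGap {F : Finset K} {lo hi a : K} (ha : a ∈ F) (hla : lo ≤ a) (hah : a < hi) :
    succF F a - a ≤ locGap F lo hi := by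
  unfold locGap
  refine (Finset.le_fold_max _).mpr (Or.inr ⟨succF F a - a, ?_, le_rfl⟩)
  exact mem_image.mpr ⟨a, mem_filter.mpr ⟨ha, hla, hah⟩, rfl⟩

/-- The window `[lo, hi]` (with `hi ∈ F`) has the successor property with constant `locGap`. -/
theorem succ_window_locGap (F : Finset K) (lo hi : K) (hhi : hi ∈ F) :
    ∀ a ∈ F, lo ≤ a → a < hi → ∃ b ∈ F, a < b ∧ b ≤ a + locGap F lo hi := by
  intro a ha hla hah
  obtain ⟨hm, hlt⟩ := succF_mem_and_lt (F := F) ⟨hi, hhi, hah⟩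
  exact ⟨succF F a, hm, hlt, by linarith [le_locGap ha hla hah]⟩

/-- **Candidate gap on a window ≤ its local spacing.** -/
theorem gap_le_locGap {F : Finset K} {lo hi x : K} (hlo : lo ∈ F) (hhi : hi ∈ F) (hlx : lo ≤ x)
    (hxh : x ≤ hi) : roundUp F x - roundDown F x ≤ locGap F lo hi :=
  gap_le_of_succ_window hlo hhi (locGap_nonneg F lo hi) (succ_window_locGap F lo hi hhi) hlx hxh

/-! ### The interval envelope -/

/-- `envI F T = Σ_{nodes v} locGap(F, [dn(lb_l + lb_r), up(ub_l + ub_r)])² / 4`. -/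
def envI (F : Finset K) : STree K → K
  | .leaf _ => 0
  | .node l r => envI F l + envI F r
      + locGap F (dn F (lbT F l + lbT F r)) (up F (ubT F l + ubT F r)) ^ 2 / 4

omit [IsStrictOrderedRing K] in
/-- Unfolding `envI` at a node. -/
theorem envI_node (F : Finset K) (l r : STree K) : envI F (.node l r) = envI F l + envI F r
    + locGap F (dn F (lbT F l + lbT F r)) (up F (ubT F l + ubT F r)) ^ 2 / 4 := rfl

/-- **Interval envelope (every tree, all leaves, no hypothesis).** `treeVar F T ≤ envI F T`. -/
theorem treeVar_le_envI {F : Finset K} (hF : F.Nonempty) : ∀ t : STree K, treeVar F t ≤ envI F t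
  | .leaf _ => by simp [treeVar, envI]
  | .node l r => by
      simp only [treeVar, envI]
      have h1 : treeExp F l (fun a => treeExp F r (fun b => srVar F (clamp F (a + b))))
          ≤ locGap F (dn F (lbT F l + lbT F r)) (up F (ubT F l + ubT F r)) ^ 2 / 4 := by
        refine treeExp_le_of_allOut F l (allOut_mono F l (fun a ha => ?_) (allOut_range hF l))
        refine treeExp_le_of_allOut F r (allOut_mono F r (fun b hb => ?_) (allOut_range hF r))
        refine (srVar_le_gap_sq_div_four F _).trans ?_
        have hgap : roundUp F (clamp F (a + b)) - roundDown F (clamp F (a + b))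
            ≤ locGap F (dn F (lbT F l + lbT F r)) (up F (ubT F l + ubT F r)) :=
          gap_le_locGap (dn_mem hF _) (up_mem hF _)
            ((dn_le_clamp F _).trans (clamp_mono hF (add_le_add ha.1 hb.1)))
            ((clamp_mono hF (add_le_add ha.2 hb.2)).trans (clamp_le_up F _))
        have h0 : 0 ≤ roundUp F (clamp F (a + b)) - roundDown F (clamp F (a + b)) :=
          sub_nonneg.mpr (roundDown_le_roundUp F _)
        have := mul_self_le_mul_self h0 hgap
        nlinarith [this]
      have h2 := treeVar_le_envI hF l
      have h3 := treeVar_le_envI hF r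
      linarith

/-- **Chebyshev with the interval envelope**: `NoSatT ⇒ P(|ŝ_T − ∑| ≥ t) ≤ envI / t²`
(and `NoSatT` itself is certified by `HullCert`). -/
theorem tree_prob_dev_ge_le_envI {F : Finset K} (hF : F.Nonempty) (T : STree K) (h : NoSatT F T)
    {t : K} (ht : 0 < t) : treeExp F T (devInd t T.exact) ≤ envI F T / t ^ 2 :=
  (tree_prob_dev_ge_le_treeVar F T h ht).trans
    (div_le_div_of_nonneg_right (treeVar_le_envI hF T) (by positivity))

/-- The same from the range certificate alone (no path predicate at all). -/
theorem tree_prob_dev_ge_le_envI_of_hullCert {F : Finset K} (hF : F.Nonempty) (T : STree K)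
    (h : HullCert F T) {t : K} (ht : 0 < t) : treeExp F T (devInd t T.exact) ≤ envI F T / t ^ 2 :=
  tree_prob_dev_ge_le_envI hF T (noSatT_of_hullCert hF T h) ht

/-- Exactness from the certificate: `NoSatT ∧ envI = 0 ⇒` the result is surely the exact sum. -/
theorem allOut_eq_exact_of_envI_eq_zero {F : Finset K} (hF : F.Nonempty) (T : STree K)
    (h : NoSatT F T) (h0 : envI F T = 0) : treeExp F T (devInd 1 T.exact) ≤ 0 := by
  have := tree_prob_dev_ge_le_envI hF T h one_pos
  rw [h0, zero_div] at this
  exact this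

/-! ### Balanced trees and kernel instances -/

/-- The perfectly balanced tree of depth `d` on the leaves `x o, …, x (o + 2^d − 1)`. -/
def balT (x : ℕ → K) : ℕ → ℕ → STree K
  | o, 0 => .leaf (x o)
  | o, d + 1 => .node (balT x o d) (balT x (o + 2 ^ d) d)

namespace Trees

/-- E3M2 test data `(1, 5/4, 3/2, 7/4, 1, 5/4, 3/2, 7/4)` (sum `11`). -/
def oct (i : ℕ) : ℚ := [1, 5/4, 3/2, 7/4, 1, 5/4, 3/2, 7/4].getD i 0

/-- **E3M2, eight leaves `oct`**: balanced `Var = 1 ≤ envI = 7/4`; sequential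
`Var = 7/4 ≤ envI = 29/8` (both without saturation, certified by ranges). -/
theorem e3m2_oct_balanced_vs_sequential :
    HullCert Formats.e3m2 (balT oct 0 3) ∧ HullCert Formats.e3m2 (comb (fun i => oct (i + 1)) (oct 0) 7)
      ∧ treeVar Formats.e3m2 (balT oct 0 3) = 1 ∧ envI Formats.e3m2 (balT oct 0 3) = 7 / 4
      ∧ treeVar Formats.e3m2 (comb (fun i => oct (i + 1)) (oct 0) 7) = 7 / 4
      ∧ envI Formats.e3m2 (comb (fun i => oct (i + 1)) (oct 0) 7) = 29 / 8 := by
  decide +kernel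

/-- **E3M2, eight copies of `5/4`**: the balanced sum is EXACT (`envI = 0`, hence `Var = 0` and the
result is surely `10`), the sequential one has `Var = 2335/1024` (`envI = 57/16`). -/
theorem e3m2_equal_leaves_balanced_exact :
    envI Formats.e3m2 (balT (fun _ => (5/4 : ℚ)) 0 3) = 0
      ∧ treeVar Formats.e3m2 (balT (fun _ => (5/4 : ℚ)) 0 3) = 0
      ∧ AllOut Formats.e3m2 (balT (fun _ => (5/4 : ℚ)) 0 3) (fun v => v = 10)
      ∧ treeVar Formats.e3m2 (comb (fun _ => (5/4 : ℚ)) (5/4) 7) = 2335 / 1024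
      ∧ envI Formats.e3m2 (comb (fun _ => (5/4 : ℚ)) (5/4) 7) = 57 / 16 := by
  decide +kernel

/-- **E3M2, `(3,3,3,3)`**: sequentially `Var = 2 = envI` (the interval envelope is tight here);
balanced exact. -/
theorem e3m2_threes :
    treeVar Formats.e3m2 (seq4 3 3 3 3) = 2 ∧ envI Formats.e3m2 (seq4 3 3 3 3) = 2
      ∧ treeVar Formats.e3m2 (bal4 3 3 3 3) = 0 ∧ envI Formats.e3m2 (bal4 3 3 3 3) = 0 := by
  decide +kernel

/-- E4M3 test data `1 + (i mod 8)/8`. -/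
def saw (i : ℕ) : ℚ := 1 + ((i % 8 : ℕ) : ℚ) / 8

/-- **E4M3, 16 leaves** (`2^15` branches — beyond the exhaustive tables): range certificates (no
saturation) and interval envelopes, balanced `15/8` vs sequential `237/32`. -/
theorem e4m3_saw16_envI :
    HullCert Formats.e4m3 (balT saw 0 4) ∧ HullCert Formats.e4m3 (comb (fun i => saw (i + 1)) (saw 0) 15)
      ∧ envI Formats.e4m3 (balT saw 0 4) = 15 / 8
      ∧ envI Formats.e4m3 (comb (fun i => saw (i + 1)) (saw 0) 15) = 237 / 32 := by
  decide +kernel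

/-- **E4M3, 32 leaves**: balanced `envI = 31/4` (so `Var ŝ_T ≤ 31/4` and
`P(|ŝ_T − 46| ≥ t) ≤ 31/(4t²)`), sequential certificate `4397/32`. -/
theorem e4m3_saw32_envI :
    HullCert Formats.e4m3 (balT saw 0 5) ∧ HullCert Formats.e4m3 (comb (fun i => saw (i + 1)) (saw 0) 31)
      ∧ envI Formats.e4m3 (balT saw 0 5) = 31 / 4
      ∧ envI Formats.e4m3 (comb (fun i => saw (i + 1)) (saw 0) 31) = 4397 / 32 := by
  decide +kernel

/-- The balanced 32-leaf E4M3 sum of `saw`: `Var ≤ 31/4` and `P(|ŝ_T − ∑| ≥ t) ≤ (31/4)/t²`, with no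
enumeration. -/
theorem e4m3_saw32_balanced_cheb {t : ℚ} (ht : 0 < t) :
    treeVar Formats.e4m3 (balT saw 0 5) ≤ 31 / 4 ∧
      treeExp Formats.e4m3 (balT saw 0 5) (devInd t (balT saw 0 5).exact) ≤ (31 / 4) / t ^ 2 := by
  obtain ⟨hb, -, he, -⟩ := e4m3_saw32_envI
  refine ⟨?_, ?_⟩
  · have := treeVar_le_envI Formats.e4m3_nonempty (balT saw 0 5); rwa [he] at this
  · have := tree_prob_dev_ge_le_envI_of_hullCert Formats.e4m3_nonempty _ hb ht; rwa [he] at this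

end Trees

end Summit.Ventures.CertifiedArithmetic.LowPrec.SR
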